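import Mathlib.LinearAlgebra.Dimension.Constructions
import Mathlib.LinearAlgebra.Dimension.Finite
import Literature.Computability.AlgebraicComplexity.Forbes15TrailingMonomials
import Literature.Barriers.ValiantsHypothesis.GKSS17FSVPresentation
import HarnessLib

/-!
# Forbes 2015, §6 — the shifted-partial measure `x^{≤ℓ}((x+α)∘∂_x)^{≤k}` on `Σm∧ΣΠ^t`

M. A. Forbes, *Deterministic divisibility testing via shifted partial derivatives*, FOCS 2015
(doi:10.1109/FOCS.2015.35; held `paper:doi-10-1109-focs-2015-35`), §6: Lemma 6.2 («we now allow
a multiplication by an arbitrary polynomial»), Cor. 6.3/6.4 (the upper bound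
`s·C(k+m,m)·C(n+tk+ℓ, tk+ℓ)` for `Σ_{i≤s} (x+α)^{a_i} f_i(g_{i,1}(x+α),…)`, here `m = 1`), and the
measure comparison inside the proof of Prop. 6.5 (p. 33: upper bound vs. the trailing-monomial
lower bound `C(‖a‖₀, k)·C(‖a‖₀ − k + ℓ, ℓ)` of Lemma 4.13 / Lemma 5.11).

Part 2 (of 4) of the proofs for the val-lit discharge of FSV 2018 Lemma 36; definitions
(`LogAffine`, `stage`, `ubFamily`, `measure`, `LBIndex`, …) in `Forbes15ShiftedPartialsDefs`.
All theorems, no named facts.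
* `LogAffine.const/X_add_C/mul/prod/pow` — the multipliers `λ(x+α)^a` of Lemma 6.2.
* `shiftDeriv_mem_stage`, `shiftDerivList_mem_stage` — one operator `(x_i+α_i)∂_i` moves stage
  `r` of `u·G^d` into stage `r+1` (the computation of Lemma 6.2 / Cor. 4.4 for `f = y^d`).
* `measure_le_span_ubFamily`, `finrank_span_ubFamily_le` — the measure of `g = Σ_i u_i G_i^{d_i}`
  lies in the span of the `s(k+1)C(n+tk+ℓ, tk+ℓ)` polynomials `u_i G_i^{d_i−j} x^c` (Cor. 6.4).
* `lbExponent_injective`, `isTrailing_lbFamily`, `card_LBIndex` — Subclaims 4.14/4.15 and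
  Lemma 5.11 for the family `E`.
* `choose_mul_choose_le` — **the measure inequality** (p. 33 of the source with `m = 1`): if the
  trailing monomial of `g` has full support with exponents nonzero in `F` (`n` variables) then
  `C(n,k)·C(n−k+ℓ, ℓ) ≤ s·(k+1)·C(n+tk+ℓ, tk+ℓ)` for all `k`, `ℓ`.
-/

open MvPolynomial
open Finsupp (single sum_single_index support_embDomain embDomain_apply_self embDomain_notin_range
  embDomain_injective embDomain)

namespace Literature.Computability.AlgebraicComplexity.Forbes15

variable {σ F : Type*} [Field F]

/-! ### Log-affine multipliers (the `(x+α)^a` of Lemma 6.2) -/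

namespace LogAffine

variable {α : σ → F}

/-- Constants are log-affine. [cite: Forbes2015, Lemma 6.2] -/
theorem const (α : σ → F) (a : F) : LogAffine α (C a : MvPolynomial σ F) := fun i =>
  ⟨0, by rw [pderiv_C, mul_zero, zero_smul]⟩

/-- `x_j + α_j` is log-affine. [cite: Forbes2015, Lemma 6.2 (chain rule `∂(x+α)^a`)] -/
theorem X_add_C (α : σ → F) (j : σ) : LogAffine α (X j + C (α j) : MvPolynomial σ F) := by
  classical
  intro i
  by_cases hij : j = i
  · subst hij
    exact ⟨1, by rw [map_add, pderiv_C, add_zero, pderiv_X_self, mul_one, one_smul]⟩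
  · exact ⟨0, by rw [map_add, pderiv_C, add_zero, pderiv_X_of_ne hij, mul_zero, zero_smul]⟩

/-- Products of log-affine polynomials are log-affine (Leibniz rule).
[cite: Forbes2015, Lemma 6.2 (product rule, Lemma 3.3)] -/
theorem mul {u v : MvPolynomial σ F} (hu : LogAffine α u) (hv : LogAffine α v) :
    LogAffine α (u * v) := by
  intro i
  obtain ⟨c, hc⟩ := hu i
  obtain ⟨c', hc'⟩ := hv i
  refine ⟨c + c', ?_⟩
  have : (X i + C (α i)) * MvPolynomial.pderiv i (u * v) =
      (X i + C (α i)) * MvPolynomial.pderiv i u * v + u * ((X i + C (α i)) *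
        MvPolynomial.pderiv i v) := by
    rw [pderiv_mul]; ring
  rw [this, hc, hc', smul_mul_assoc, mul_smul_comm, add_smul]

/-- Finite products of log-affine polynomials are log-affine. [cite: Forbes2015, Lemma 6.2] -/
theorem prod {ι : Type*} (s : Finset ι) (f : ι → MvPolynomial σ F)
    (h : ∀ i ∈ s, LogAffine α (f i)) : LogAffine α (∏ i ∈ s, f i) := by
  classical
  induction s using Finset.induction_on with
  | empty => simpa using const α (1 : F)
  | insert a s ha ih =>
    rw [Finset.prod_insert ha]
    exact (h a (Finset.mem_insert_self a s)).mul
      (ih fun i hi => h i (Finset.mem_insert_of_mem hi))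

/-- Powers of log-affine polynomials are log-affine. [cite: Forbes2015, Lemma 6.2] -/
theorem pow {u : MvPolynomial σ F} (hu : LogAffine α u) (n : ℕ) : LogAffine α (u ^ n) := by
  induction n with
  | zero => simpa using const α (1 : F)
  | succ n ih => rw [pow_succ]; exact ih.mul hu

end LogAffine

/-! ### Degree bookkeeping -/

/-- `deg ∂_{x_i} p ≤ deg p − 1`. [cite: Forbes2015, §3.1 (derivatives lower degree)] -/
theorem totalDegree_pderiv_le (i : σ) (p : MvPolynomial σ F) :
    (MvPolynomial.pderiv i p).totalDegree ≤ p.totalDegree - 1 := by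
  rw [totalDegree_eq]
  refine Finset.sup_le fun d hd => ?_
  rw [MvPolynomial.mem_support_iff, coeff_pderiv] at hd
  have hd' : coeff (d + single i 1) p ≠ 0 := fun h0 => hd (by rw [h0, zero_mul])
  have h1 := le_totalDegree (MvPolynomial.mem_support_iff.mpr hd')
  rw [Finsupp.sum_add_index' (fun _ => rfl) (fun _ _ _ => rfl), sum_single_index rfl] at h1
  have h2 : (Finsupp.toMultiset d).card = d.sum fun _ e => e := Finsupp.card_toMultiset d
  omega

/-- `deg (x_i + a) ≤ 1`. [cite: Forbes2015, Lemma 6.2 («deg (x+α)^b = deg x^b»)] -/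
theorem totalDegree_X_add_C_le (i : σ) (a : F) :
    (X i + C a : MvPolynomial σ F).totalDegree ≤ 1 :=
  (totalDegree_add _ _).trans (max_le (totalDegree_X (R := F) i).le (by rw [totalDegree_C]; simp))

/-- `deg ((x_i + a)·∂_{x_i} p) ≤ deg p`. [cite: Forbes2015, Lemma 6.2 («deg x^c (x+α)^{b−i} ≤ ℓ+k»)] -/
theorem totalDegree_shift_pderiv_le (i : σ) (a : F) (p : MvPolynomial σ F) :
    ((X i + C a) * MvPolynomial.pderiv i p).totalDegree ≤ p.totalDegree := by
  by_cases hp : MvPolynomial.pderiv i p = 0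
  · rw [hp, mul_zero, totalDegree_zero]; exact Nat.zero_le _
  · have h1 : 1 ≤ p.totalDegree := by
      by_contra h0
      push Not at h0
      have : p.totalDegree = 0 := by omega
      rw [totalDegree_eq_zero_iff_eq_C] at this
      exact hp (by rw [this, pderiv_C])
    calc ((X i + C a) * MvPolynomial.pderiv i p).totalDegree
        ≤ (X i + C a : MvPolynomial σ F).totalDegree + (MvPolynomial.pderiv i p).totalDegree :=
          totalDegree_mul _ _
      _ ≤ 1 + (p.totalDegree - 1) :=
          add_le_add (totalDegree_X_add_C_le i a) (totalDegree_pderiv_le i p)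
      _ = p.totalDegree := by omega

/-! ### The stages `u · G^{d−j} · F[x]_{≤ tj}` (Lemma 6.2 / Cor. 6.3 with `f = y^d`) -/

/-- Stages increase with `r`. [cite: Forbes2015, Lemma 6.2] -/
theorem stage_mono (u G : MvPolynomial σ F) (d t : ℕ) {r r' : ℕ} (h : r ≤ r') :
    stage u G d t r ≤ stage u G d t r' :=
  Submodule.span_mono fun _ ⟨j, hj, P, hP, hq⟩ => ⟨j, hj.trans h, P, hP, hq⟩

/-- `u·G^d` lies in stage `0`. [cite: Forbes2015, Lemma 6.2] -/
theorem mem_stage_zero (u G : MvPolynomial σ F) (d t : ℕ) : u * G ^ d ∈ stage u G d t 0 :=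
  Submodule.subset_span ⟨0, le_rfl, 1, by simp, by simp⟩

/-- **Forbes Lemma 6.2 / Cor. 6.3 (one operator):** `(x_i+α_i)∂_i` maps stage `r` of `u·G^d`
into stage `r+1`, for log-affine `u` and `deg G ≤ t`:
`(x_i+α_i)∂_i(u G^{d−j} P) = c·uG^{d−j}P + uG^{d−j−1}·((d−j)(x_i+α_i)∂_iG·P) + uG^{d−j}·((x_i+α_i)∂_iP)`.
[cite: Forbes2015, Lemma 6.2, Cor. 6.3] -/
theorem shiftDeriv_mem_stage {α : σ → F} {u G : MvPolynomial σ F} (hu : LogAffine α u) {t : ℕ}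
    (hG : G.totalDegree ≤ t) (d : ℕ) {r : ℕ} {q : MvPolynomial σ F} (hq : q ∈ stage u G d t r)
    (i : σ) : shiftDeriv α i q ∈ stage u G d t (r + 1) := by
  induction hq using Submodule.span_induction with
  | zero => rw [map_zero]; exact Submodule.zero_mem _
  | add x y _ _ hx hy => rw [map_add]; exact Submodule.add_mem _ hx hy
  | smul a x _ hx => rw [map_smul]; exact Submodule.smul_mem _ a hx
  | mem q hq =>
    obtain ⟨j, hj, P, hP, rfl⟩ := hq
    obtain ⟨c, hc⟩ := hu i
    set ξ : MvPolynomial σ F := X i + C (α i) with hξ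
    have key : shiftDeriv α i (u * G ^ (d - j) * P) =
        c • (u * G ^ (d - j) * P) +
        u * G ^ (d - (j + 1)) * (((d - j : ℕ) : MvPolynomial σ F) * (ξ * MvPolynomial.pderiv i G) * P) +
        u * G ^ (d - j) * (ξ * MvPolynomial.pderiv i P) := by
      rw [shiftDeriv_apply, ← hξ, pderiv_mul, pderiv_mul, pderiv_pow, ← smul_mul_assoc,
        ← smul_mul_assoc, ← hc, show d - j - 1 = d - (j + 1) by omega]
      ring
    rw [key]
    refine Submodule.add_mem _ (Submodule.add_mem _ ?_ ?_) ?_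
    · exact Submodule.smul_mem _ c (stage_mono u G d t (Nat.le_succ r)
        (Submodule.subset_span ⟨j, hj, P, hP, rfl⟩))
    · refine Submodule.subset_span ⟨j + 1, by omega, _, ?_, rfl⟩
      calc (((d - j : ℕ) : MvPolynomial σ F) * (ξ * MvPolynomial.pderiv i G) * P).totalDegree
          ≤ (((d - j : ℕ) : MvPolynomial σ F) * (ξ * MvPolynomial.pderiv i G)).totalDegree +
              P.totalDegree := totalDegree_mul _ _
        _ ≤ (((d - j : ℕ) : MvPolynomial σ F).totalDegree +
              (ξ * MvPolynomial.pderiv i G).totalDegree) + P.totalDegree :=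
            add_le_add_left (totalDegree_mul _ _) _
        _ ≤ (0 + t) + t * j := by
            refine add_le_add (add_le_add ?_ ((totalDegree_shift_pderiv_le i _ G).trans hG)) hP
            rw [← map_natCast (C : F →+* MvPolynomial σ F), totalDegree_C]
        _ = t * (j + 1) := by ring
    · refine Submodule.subset_span ⟨j, by omega, _, ?_, rfl⟩
      exact (totalDegree_shift_pderiv_le i _ P).trans hP

/-- Iterating: `(x+α)^{1_L}∂_{x^{1_L}}(u·G^d)` lies in stage `|L|`. [cite: Forbes2015, Cor. 6.3] -/
theorem shiftDerivList_mem_stage {α : σ → F} {u G : MvPolynomial σ F} (hu : LogAffine α u)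
    {t : ℕ} (hG : G.totalDegree ≤ t) (d : ℕ) (L : List σ) :
    shiftDerivList α L (u * G ^ d) ∈ stage u G d t L.length := by
  induction L with
  | nil => exact mem_stage_zero u G d t
  | cons i L ih =>
    rw [shiftDerivList_cons, List.length_cons]
    exact shiftDeriv_mem_stage hu hG d ih i

/-! ### Cor. 6.4 (`m = 1`): the spanning family and the measure -/

/-- `u_i G_i^{d_i−j} P ∈ span(ubFamily)` for `deg P ≤ D`, `j ≤ k` (expand `P` in monomials).
[cite: Forbes2015, Cor. 6.4] -/
theorem mul_mem_span_ubFamily {s : ℕ} (u G : Fin s → MvPolynomial σ F) (d : Fin s → ℕ) (D k : ℕ)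
    (i : Fin s) {j : ℕ} (hj : j ≤ k) {P : MvPolynomial σ F} (hP : P.totalDegree ≤ D) :
    u i * G i ^ (d i - j) * P ∈ Submodule.span F (Set.range (ubFamily u G d D k)) := by
  rw [P.as_sum, Finset.mul_sum]
  refine Submodule.sum_mem _ fun v hv => ?_
  have hvD : v.degree ≤ D := by
    have := le_totalDegree hv
    exact le_trans (le_of_eq (Finsupp.degree_apply v)) (this.trans hP)
  have : u i * G i ^ (d i - j) * monomial v (coeff v P) =
      coeff v P • ubFamily u G d D k (i, ⟨j, Nat.lt_succ_of_le hj⟩, ⟨v, hvD⟩) := by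
    rw [ubFamily, ← mul_smul_comm, smul_monomial, smul_eq_mul, mul_one]
  rw [this]
  exact Submodule.smul_mem _ _ (Submodule.subset_span ⟨_, rfl⟩)

/-- Everything in stage `r ≤ k` of `u_i G_i^{d_i}`, multiplied by `x^c` with `deg c ≤ ℓ`, lies in
`span(ubFamily)` with `D = tk + ℓ`. [cite: Forbes2015, Cor. 6.4] -/
theorem monomial_mul_mem_span_ubFamily {s : ℕ} (u G : Fin s → MvPolynomial σ F) (d : Fin s → ℕ)
    {t k ℓ r : ℕ} (hr : r ≤ k) (i : Fin s) {q : MvPolynomial σ F}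
    (hq : q ∈ stage (u i) (G i) (d i) t r) {c : σ →₀ ℕ} (hc : c.degree ≤ ℓ) :
    monomial c (1 : F) * q ∈ Submodule.span F (Set.range (ubFamily u G d (t * k + ℓ) k)) := by
  induction hq using Submodule.span_induction with
  | zero => rw [mul_zero]; exact Submodule.zero_mem _
  | add x y _ _ hx hy => rw [mul_add]; exact Submodule.add_mem _ hx hy
  | smul a x _ hx => rw [mul_smul_comm]; exact Submodule.smul_mem _ a hx
  | mem q hq =>
    obtain ⟨j, hj, P, hP, rfl⟩ := hq
    have : monomial c (1 : F) * (u i * G i ^ (d i - j) * P) =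
        u i * G i ^ (d i - j) * (monomial c 1 * P) := by ring
    rw [this]
    refine mul_mem_span_ubFamily u G d _ k i (hj.trans hr) ?_
    calc (monomial c (1 : F) * P).totalDegree
        ≤ (monomial c (1 : F)).totalDegree + P.totalDegree := totalDegree_mul _ _
      _ ≤ ℓ + t * j := by
          refine add_le_add ?_ hP
          rw [totalDegree_monomial _ one_ne_zero]
          exact le_trans (le_of_eq (Finsupp.degree_apply c).symm) hc
      _ ≤ t * k + ℓ := by nlinarith

/-- **Forbes Cor. 6.4 (`m = 1`), containment form:** the measure of `g = Σ_i u_i G_i^{d_i}`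
(`u_i` log-affine, `deg G_i ≤ t`) lies in the span of `ubFamily` with `D = tk + ℓ`.
[cite: Forbes2015, Cor. 6.4] -/
theorem measure_le_span_ubFamily [Fintype σ] {α : σ → F} {s t k ℓ : ℕ}
    {u G : Fin s → MvPolynomial σ F} {d : Fin s → ℕ} (hu : ∀ i, LogAffine α (u i))
    (hG : ∀ i, (G i).totalDegree ≤ t) :
    measure α (∑ i, u i * G i ^ d i) k ℓ ≤
      Submodule.span F (Set.range (ubFamily u G d (t * k + ℓ) k)) := by
  refine Submodule.span_le.mpr ?_
  rintro q ⟨B, hB, c, hc, rfl⟩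
  rw [map_sum, Finset.mul_sum]
  refine Submodule.sum_mem _ fun i _ => ?_
  refine monomial_mul_mem_span_ubFamily u G d (le_of_eq ?_) i
    (shiftDerivList_mem_stage (hu i) (hG i) (d i) B.toList) hc
  rw [Finset.length_toList, hB]

/-- `dim span(ubFamily) ≤ s·(k+1)·C(n + D, D)` over `n` variables.
[cite: Forbes2015, Cor. 6.4 (`m = 1`: `s·C(k+1,1)·C(n+tk+ℓ, tk+ℓ)`)] -/
theorem finrank_span_ubFamily_le {n s : ℕ} (u G : Fin s → MvPolynomial (Fin n) F)
    (d : Fin s → ℕ) (D k : ℕ) :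
    Module.finrank F (Submodule.span F (Set.range (ubFamily u G d D k))) ≤
      s * (k + 1) * (n + D).choose D := by
  haveI : Fintype {c : Fin n →₀ ℕ // c.degree ≤ D} :=
    (Finsupp.finite_of_degree_le (σ := Fin n) D).fintype
  refine (finrank_range_le_card _).trans (le_of_eq ?_)
  rw [Fintype.card_prod, Fintype.card_prod, Fintype.card_fin, Fintype.card_fin,
    ← Nat.card_eq_fintype_card,
    Literature.Barriers.ValiantsHypothesis.GKSS2017.ncard_degLE, mul_assoc]

/-! ### The lower-bound family (Lemma 4.13's set `E`) and the measure inequality -/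

section LowerBound

variable {n k : ℕ}

/-- `complEmb B` avoids `B`. [cite: Forbes2015, Lemma 4.13] -/
theorem complEmb_not_mem (B : Finset (Fin n)) (hB : B.card = k) (j : Fin (n - k)) :
    complEmb B hB j ∉ B := by
  have := Finset.orderEmbOfFin_mem (Bᶜ) (by rw [Finset.card_compl, Fintype.card_fin, hB]) j
  rwa [Finset.mem_compl] at this

/-- The pushed shift exponent has the same degree `≤ ℓ`. [cite: Forbes2015, Lemma 4.13] -/
theorem degree_shift {ℓ : ℕ} (x : LBIndex n k ℓ) : Finsupp.degree x.shift ≤ ℓ := by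
  have : Finsupp.degree x.shift = Finsupp.degree x.2.1 := by
    rw [LBIndex.shift, Finsupp.degree_apply, Finsupp.degree_apply, support_embDomain,
      Finset.sum_map]
    refine Finset.sum_congr rfl fun j _ => ?_
    exact embDomain_apply_self _ _ _
  rw [this]; exact x.2.2

/-- The pushed shift exponent vanishes on `B`. [cite: Forbes2015, Lemma 4.13] -/
theorem shift_apply_of_mem {ℓ : ℕ} (x : LBIndex n k ℓ) {i : Fin n} (hi : i ∈ x.1.1) :
    x.shift i = 0 := by
  rw [LBIndex.shift]
  refine embDomain_notin_range _ _ _ ?_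
  rintro ⟨j, rfl⟩
  exact complEmb_not_mem _ _ j hi

/-- Members of the lower-bound family lie in the measure. [cite: Forbes2015, Lemma 4.13] -/
theorem lbFamily_mem_measure (α : Fin n → F) (g : MvPolynomial (Fin n) F) (k ℓ : ℕ)
    (x : LBIndex n k ℓ) : lbFamily α g k ℓ x ∈ measure α g k ℓ :=
  Submodule.subset_span ⟨x.1.1, x.1.2, x.shift, degree_shift x, rfl⟩

/-- **Forbes Subclaim 4.14:** the exponents `a − 1_B + c`, `(B, c) ∈ E`, are pairwise distinct
(recover `B = {i : (a − 1_B + c)_i < a_i}`, then `c`), provided `a` has full support.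
[cite: Forbes2015, Subclaim 4.14] -/
theorem lbExponent_injective (a : Fin n →₀ ℕ) (ha : ∀ i, 1 ≤ a i) (k ℓ : ℕ) :
    Function.Injective (lbExponent a (k := k) (ℓ := ℓ)) := by
  classical
  have hB : ∀ (x : LBIndex n k ℓ) (i : Fin n), i ∈ x.1.1 ↔ lbExponent a x i < a i := by
    intro x i
    rw [lbExponent, Finsupp.add_apply, Finsupp.tsub_apply]
    by_cases hi : i ∈ x.1.1
    · rw [shift_apply_of_mem x hi, listIndicator_apply_of_mem_of_nodup _ (Finset.nodup_toList _)
        (Finset.mem_toList.mpr hi)]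
      have := ha i
      exact ⟨fun _ => by omega, fun _ => hi⟩
    · rw [listIndicator_apply_of_not_mem _ (fun h => hi (Finset.mem_toList.mp h))]
      exact ⟨fun h => absurd h hi, fun h => by omega⟩
  rintro ⟨⟨B₁, hB₁⟩, c₁⟩ ⟨⟨B₂, hB₂⟩, c₂⟩ h
  have hBeq : B₁ = B₂ := by
    ext i
    have h1 := hB ⟨⟨B₁, hB₁⟩, c₁⟩ i
    have h2 := hB ⟨⟨B₂, hB₂⟩, c₂⟩ i
    simp only at h1 h2
    rw [h1, h2, h]
  subst hBeq
  have hshift : embDomain (complEmb B₁ hB₁) c₁.1 = embDomain (complEmb B₁ hB₁) c₂.1 := by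
    unfold lbExponent LBIndex.shift at h
    exact add_right_cancel h
  have hc : c₁.1 = c₂.1 := embDomain_injective _ hshift
  rw [Prod.mk.injEq]
  exact ⟨rfl, Subtype.ext hc⟩

variable {Λ : Type*} [AddCommMonoid Λ] [LinearOrder Λ] [IsOrderedCancelAddMonoid Λ]

/-- Each member of the lower-bound family has trailing exponent `a − 1_B + c`
(Lemma 5.11 + Lemma 3.6), when `a` is the trailing monomial of `g` with exponents nonzero in
`F` and `α` has full support. [cite: Forbes2015, Lemma 5.11, Subclaim 4.14] -/
theorem isTrailing_lbFamily {r : (Fin n →₀ ℕ) →+ Λ} (hr : Function.Injective r)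
    (hmono : Monotone r) {α : Fin n → F} (hα : ∀ i, α i ≠ 0) {g : MvPolynomial (Fin n) F}
    {a : Fin n →₀ ℕ} (hg : IsTrailing r g a) (ha : ∀ i, (a i : F) ≠ 0) (k ℓ : ℕ)
    (x : LBIndex n k ℓ) : IsTrailing r (lbFamily α g k ℓ x) (lbExponent a x) :=
  (hg.shiftDerivList hr hmono α _ (Finset.nodup_toList _) (fun i _ => ha i)
    (fun i _ => hα i)).monomial_mul _

/-- `|E| = C(n, k) · C(n − k + ℓ, ℓ)`. [cite: Forbes2015, Subclaim 4.15] -/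
theorem card_LBIndex (n k ℓ : ℕ) :
    Nat.card (LBIndex n k ℓ) = n.choose k * (n - k + ℓ).choose ℓ := by
  rw [LBIndex, Nat.card_prod, Literature.Barriers.ValiantsHypothesis.GKSS2017.ncard_degLE,
    Nat.card_eq_fintype_card, Fintype.card_finset_len, Fintype.card_fin]

/-- **The measure inequality (Forbes, proof of Prop. 6.5, p. 33, with `m = 1`):** if
`g = Σ_{i<s} u_i G_i^{d_i}` (`u_i` log-affine for a full-support `α`, `deg G_i ≤ t`) over `n`
variables has a trailing monomial `a` of full support whose exponents are nonzero in `F`, then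
for all `k`, `ℓ`:  `C(n,k)·C(n−k+ℓ, ℓ) ≤ s·(k+1)·C(n+tk+ℓ, tk+ℓ)`.
[cite: Forbes2015, Prop. 6.5 (proof), Cor. 6.4, Lemma 4.13, Lemma 5.11] -/
theorem choose_mul_choose_le {s t : ℕ} {r : (Fin n →₀ ℕ) →+ Λ} (hr : Function.Injective r)
    (hmono : Monotone r) {α : Fin n → F} (hα : ∀ i, α i ≠ 0)
    {u G : Fin s → MvPolynomial (Fin n) F} {d : Fin s → ℕ} (hu : ∀ i, LogAffine α (u i))
    (hG : ∀ i, (G i).totalDegree ≤ t) {a : Fin n →₀ ℕ}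
    (hg : IsTrailing r (∑ i, u i * G i ^ d i) a) (ha : ∀ i, (a i : F) ≠ 0) (k ℓ : ℕ) :
    n.choose k * (n - k + ℓ).choose ℓ ≤ s * (k + 1) * (n + (t * k + ℓ)).choose (t * k + ℓ) := by
  classical
  haveI : Finite {c : Fin (n - k) →₀ ℕ // c.degree ≤ ℓ} :=
    (Finsupp.finite_of_degree_le (σ := Fin (n - k)) ℓ).to_subtype
  haveI : Finite {c : Fin n →₀ ℕ // c.degree ≤ t * k + ℓ} :=
    (Finsupp.finite_of_degree_le (σ := Fin n) (t * k + ℓ)).to_subtype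
  haveI : Fintype (LBIndex n k ℓ) := Fintype.ofFinite _
  set W := Submodule.span F (Set.range (ubFamily u G d (t * k + ℓ) k)) with hW
  haveI : Module.Finite F W := Module.Finite.span_of_finite F (Set.finite_range _)
  have hmem : ∀ x : LBIndex n k ℓ, lbFamily α (∑ i, u i * G i ^ d i) k ℓ x ∈ W := fun x =>
    measure_le_span_ubFamily hu hG (lbFamily_mem_measure α _ k ℓ x)
  have ha1 : ∀ i, 1 ≤ a i := fun i =>
    Nat.one_le_iff_ne_zero.mpr fun h0 => ha i (by rw [h0, Nat.cast_zero])
  have hli : LinearIndependent F (lbFamily α (∑ i, u i * G i ^ d i) k ℓ) :=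
    linearIndependent_of_isTrailing hr _ _ (lbExponent_injective a ha1 k ℓ)
      (isTrailing_lbFamily hr hmono hα hg ha k ℓ)
  have hli' : LinearIndependent F (fun x : LBIndex n k ℓ =>
      (⟨lbFamily α (∑ i, u i * G i ^ d i) k ℓ x, hmem x⟩ : W)) :=
    LinearIndependent.of_comp W.subtype (by exact hli)
  have h1 := hli'.fintype_card_le_finrank
  rw [← Nat.card_eq_fintype_card, card_LBIndex] at h1
  exact h1.trans (finrank_span_ubFamily_le u G d _ k)

end LowerBound

end Literature.Computability.AlgebraicComplexity.Forbes15
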